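import Summits.BirchSwinnertonDyer.BirchSwinnertonDyer.Theorems.ResidualThetaTransportAtTwoThetaLayerLambdaCongruenceAtTwoDualChainParabolic
import Summits.BirchSwinnertonDyer.BirchSwinnertonDyer.Theorems.ResidualThetaTransportAtTwoThetaLayerLambdaCongruenceAtTwoManinSystemFactor
import Summits.BirchSwinnertonDyer.BirchSwinnertonDyer.Theorems.ResidualThetaTransportAtTwoThetaLayerLambdaCongruenceAtTwoParabolicCharacterFactor
import HarnessLib

/-!
# Crux `ThetaLayerLambdaCongruenceAtTwo` (stmt-BirchSwinnertonDyer-20688, route ResidualThetaTransportAtTwo), line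
# `birth` v13 — SD floor, brick S4 (part 5, assembly): a BI-ADDITIVE CROSSING PAIRING on the period lattice
# `Λ = H₁(X₀(N), ℤ) ⊂ S₂(Γ₀(N))^∨` whose value on `({∞, γ∞}, {∞, γ'∞})` is the signed crossing count of a dual chain of `γ`
# with a Manin chain of `γ'` (width seat bsd-wall-rtt-p3-w2 g8; `--supports stmt-BirchSwinnertonDyer-20688 --as helper`; closes nothing)

HONEST FRAMING. THEOREMS only; the pairing is produced as an EXISTENCE statement (`∃ B : Λ →+ Λ →+ ℤ` with the crossing formula);
no perfectness and no Hecke-adjointness is claimed here, so this is NOT yet the named fact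
`periodHomology_exists_heckeSelfAdjoint_perfectPairing`; nothing about any curve or form is asserted; BSD is not proved by any of this.

WHAT (`exists_biadditive_crossingPairing`). For every `N ≥ 1` there is `B : periodHomology N →+ (periodHomology N →+ ℤ)` such that for
all `γ, γ' ∈ Γ₀(N)`, every dual chain `D` of `γ` (`…DualChain`) and every Manin chain `L` of `γ'` (`…ManinChain`):
  `B {∞, γ∞} {∞, γ'∞} = Σ_{g ∈ L} vec(D)(g⁻¹Γ₀(N))`,
the signed number of crossings of the dual-tree walk of `γ` with the Farey path of `γ'` (projected to `X₀(N)`). Assembly of the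
landed bricks: `vec(D)` is an integral Manin system (`…DualChain`), so `φ_{vec D} : Λ →+ ℤ` with the chain-sum formula exists
(`…ManinSystemFactor`); `γ ↦ φ_{vec D_γ}(x)` is additive (`dualChainVec_mul`), kills the order-4 elliptics (`dualChainVec_eq_zero_of_conj_S`)
and the cusp stabilisers (`dualChainVec_chainSum_eq_zero_of_conj_upper`), hence depends only on `{∞, γ∞}`
(`character_eq_of_periodFunctional_eq` over `ℤ`); both slots are additive. This is the bridge `θ : Λ → Hom(Λ, ℤ)` of
`Cruxes/…/Lines/birth-sd2-architecture.md` (with signs — the architecture works over `ℤ`). REMAINING for the named fact IP / its consumed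
`ℓ = 2` shadow SD₂: surjectivity of `θ` (path lifting ⇒ perfect by rank `2g`), `T_p`-adjointness, `U_q† = w_N U_q w_N`.

References: [Manin1972] §1.5–1.7, Thm. 1.6, Thm. 1.9; J.-P. Serre, Trees, §I.4; [Merel1995Homologie] §1.2; [CremonaAlgorithms1997] §2.1–2.2.
-/

set_option autoImplicit false

noncomputable section

-- justification: the `Summit.BirchSwinnertonDyer.BirchSwinnertonDyer.…` path repeats a component (route-file convention)
set_option linter.dupNamespace false

open scoped Classical MatrixGroups

open CongruenceSubgroup Matrix.SpecialLinearGroup ModularGroup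
open Literature.NumberTheory.EllipticCurves.ModularForms

namespace Summit.BirchSwinnertonDyer.BirchSwinnertonDyer.Theorems.ThetaLayerLambdaCongruenceAtTwo

section Pairing

variable {N : ℕ} [NeZero N]

/-- **The crossing pairing on `H₁(X₀(N), ℤ)` exists and is bi-additive.** There is `B : Λ →+ (Λ →+ ℤ)`, `Λ = periodHomology N`, with
`B {∞, γ∞} {∞, γ'∞} = Σ_{g ∈ L} vec(D)(g⁻¹Γ₀(N))` for all `γ, γ' ∈ Γ₀(N)`, every dual chain `D` of `γ` and every Manin chain `L` of `γ'`
(`vec(D) = Σ_{h∈D} (e_{h⁻¹Γ₀} − e_{(hS)⁻¹Γ₀})` the signed crossing vector). [cite: Manin1972, Thm. 1.9] [cite: Merel1995Homologie, §1.2] -/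
theorem exists_biadditive_crossingPairing :
    ∃ B : periodHomology N →+ (periodHomology N →+ ℤ), ∀ (γ γ' : Gamma0 N) (D L : List SL(2, ℤ)),
      (∀ {A : Type} [AddCommGroup A] (G : SL(2, ℤ) → A), (∀ x, G (x * (S * T⁻¹)) = G x) → (∀ x, G (-x) = G x) →
        (D.map fun h ↦ G h - G (h * S)).sum = G (γ : SL(2, ℤ)) - G 1) →
      (∀ {A : Type} [AddCommGroup A] (F : SL(2, ℤ) → A), (∀ g, F (g * T) = F g) → (∀ g, F (-g) = F g) →
        (L.map fun g ↦ F g - F (g * S)).sum = F (γ' : SL(2, ℤ)) - F 1) →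
      B ⟨periodFunctional N γ, periodFunctional_mem_periodHomology N γ⟩
        ⟨periodFunctional N γ', periodFunctional_mem_periodHomology N γ'⟩ =
        (L.map fun g ↦ (D.map fun h ↦ (Pi.single ((h⁻¹ : SL(2, ℤ)) : Gamma0Coset N) (1 : ℤ) -
          Pi.single (((h * S)⁻¹ : SL(2, ℤ)) : Gamma0Coset N) 1 : Gamma0Coset N → ℤ)).sum ((g⁻¹ : SL(2, ℤ)) : Gamma0Coset N)).sum := by
  have h3 : ∀ r : ℤ, r + r + r = 0 → r = 0 := fun r h ↦ by omega
  -- chosen dual chains and their crossing vectors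
  choose Dc hDc using fun γ : Gamma0 N ↦ exists_dualChain (γ : SL(2, ℤ))
  let vec : Gamma0 N → (Gamma0Coset N → ℤ) := fun γ ↦
    ((Dc γ).map fun h ↦ (Pi.single ((h⁻¹ : SL(2, ℤ)) : Gamma0Coset N) (1 : ℤ) -
      Pi.single (((h * S)⁻¹ : SL(2, ℤ)) : Gamma0Coset N) 1 : Gamma0Coset N → ℤ)).sum
  have hvec : ∀ γ, vec γ = ((Dc γ).map fun h ↦ (Pi.single ((h⁻¹ : SL(2, ℤ)) : Gamma0Coset N) (1 : ℤ) -
      Pi.single (((h * S)⁻¹ : SL(2, ℤ)) : Gamma0Coset N) 1 : Gamma0Coset N → ℤ)).sum := fun γ ↦ rfl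
  -- the additive maps `φ_γ : Λ →+ ℤ` (…ManinSystemFactor)
  have hφ : ∀ γ : Gamma0 N, ∃ φ : periodHomology N →+ ℤ, ∀ (k : Gamma0 N) (L : List SL(2, ℤ)),
      (∀ {A : Type} [AddCommGroup A] (F : SL(2, ℤ) → A), (∀ g, F (g * T) = F g) → (∀ g, F (-g) = F g) →
        (L.map fun g ↦ F g - F (g * S)).sum = F (k : SL(2, ℤ)) - F 1) →
      φ ⟨periodFunctional N k, periodFunctional_mem_periodHomology N k⟩ =
        (L.map fun g ↦ vec γ ((g⁻¹ : SL(2, ℤ)) : Gamma0Coset N)).sum := fun γ ↦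
    exists_addMonoidHom_periodHomology_of_maninSystem (vec γ)
      (fun q ↦ by rw [hvec]; exact dualChainVec_smul_S (Dc γ) q)
      (fun q ↦ by rw [hvec]; exact dualChainVec_three_term γ (Dc γ) (hDc γ) q)
      (fun q hq ↦ by rw [hvec]; exact dualChainVec_eq_zero_of_S_fixed (Dc γ) q hq)
      (fun q hq ↦ by rw [hvec]; exact dualChainVec_eq_zero_of_TS_fixed γ (Dc γ) (hDc γ) q hq) h3
  choose φ hφ using hφ
  -- sections: every element of `Λ` is a period functional, with a Manin chain
  have hsurj : ∀ x : periodHomology N, ∃ γ : Gamma0 N, periodFunctional N γ = (x : Module.Dual ℂ (CuspForm (Gamma0 N) 2)) :=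
    fun x ↦ by
      have hx : (x : Module.Dual ℂ (CuspForm (Gamma0 N) 2)) ∈ (periodHomology N : Set (Module.Dual ℂ (CuspForm (Gamma0 N) 2))) :=
        x.2
      rw [coe_periodHomology_eq_range] at hx
      exact hx
  choose sec hsec using hsurj
  choose Lc hLc using fun k : Gamma0 N ↦ exists_maninChain.{0} (k : SL(2, ℤ))
  have hxe : ∀ x : periodHomology N, (⟨periodFunctional N (sec x), periodFunctional_mem_periodHomology N (sec x)⟩ : periodHomology N) = x :=
    fun x ↦ Subtype.ext (hsec x)
  -- `γ ↦ φ_γ(x)` is a cusp-elliptic character for every `x`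
  have hadd : ∀ (x : periodHomology N) (γ₁ γ₂ : Gamma0 N), φ (γ₁ * γ₂) x = φ γ₁ x + φ γ₂ x := by
    intro x γ₁ γ₂
    rw [← hxe x, hφ (γ₁ * γ₂) (sec x) (Lc (sec x)) (hLc (sec x)), hφ γ₁ (sec x) (Lc (sec x)) (hLc (sec x)),
      hφ γ₂ (sec x) (Lc (sec x)) (hLc (sec x)), ← List.sum_map_add]
    congr 1
    refine List.map_congr_left fun g _ ↦ ?_
    rw [hvec, hvec, hvec]
    exact dualChainVec_mul γ₁ γ₂ (Dc γ₁) (Dc γ₂) (Dc (γ₁ * γ₂)) (hDc γ₁) (hDc γ₂) (hDc (γ₁ * γ₂)) _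
  have hstab : ∀ (x : periodHomology N) (γ : Gamma0 N) (k : SL(2, ℤ)), (k⁻¹ * (γ : SL(2, ℤ)) * k) 1 0 = 0 → φ γ x = 0 := by
    intro x γ k hk
    rw [← hxe x, hφ γ (sec x) (Lc (sec x)) (hLc (sec x))]
    have := dualChainVec_chainSum_eq_zero_of_conj_upper γ k hk (Dc γ) (hDc γ) (sec x) (Lc (sec x)) (hLc (sec x))
    simpa only [hvec] using this
  have hell : ∀ (x : periodHomology N) (γ : Gamma0 N) (k : SL(2, ℤ)), (γ : SL(2, ℤ)) * k = k * S → φ γ x = 0 := by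
    intro x γ k hk
    rw [← hxe x, hφ γ (sec x) (Lc (sec x)) (hLc (sec x))]
    refine List.sum_eq_zero fun v hv ↦ ?_
    obtain ⟨g, -, rfl⟩ := List.mem_map.mp hv
    rw [hvec]
    exact dualChainVec_eq_zero_of_conj_S γ k hk (Dc γ) (hDc γ) _
  -- hence `φ_γ(x)` depends only on `{∞, γ∞}`
  have hwd : ∀ (x : periodHomology N) (γ δ : Gamma0 N), periodFunctional N γ = periodFunctional N δ → φ γ x = φ δ x :=
    fun x γ δ h ↦ character_eq_of_periodFunctional_eq (fun γ ↦ φ γ x) (hadd x) (hstab x) (hell x) h3 γ δ h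
  -- the pairing
  refine ⟨{ toFun := fun y ↦ φ (sec y), map_zero' := ?_, map_add' := ?_ }, ?_⟩
  · -- `φ_{sec 0} = φ_1 = 0`
    ext x
    rw [AddMonoidHom.zero_apply, hwd x (sec 0) 1 (by rw [hsec, periodFunctional_one]; rfl)]
    have h11 := hadd x 1 1
    rw [one_mul] at h11
    omega
  · intro y₁ y₂
    ext x
    rw [AddMonoidHom.add_apply, ← hadd]
    refine hwd x _ _ ?_
    rw [periodFunctional_mul, hsec, hsec, hsec]
    rfl
  · intro γ γ' D L hD hL
    show φ (sec _) ⟨periodFunctional N γ', _⟩ = _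
    rw [hwd _ (sec _) γ (by rw [hsec]), hφ γ γ' L hL]
    congr 1
    refine List.map_congr_left fun g _ ↦ ?_
    rw [hvec]
    exact dualChainVec_eq_of_dualChain _ _ _ (hDc γ) hD _

end Pairing

end Summit.BirchSwinnertonDyer.BirchSwinnertonDyer.Theorems.ThetaLayerLambdaCongruenceAtTwo

end
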